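import Literature.Analysis.FluidPDE.NSBoundedCaloricDuality
import Literature.Analysis.FluidPDE.CaloricDualTestFields
import HarnessLib

/-!
# The caloric duality identity with viscosity and force (Lemarié-Rieusset 2016, §13.9 Step 3)

Analysis/FluidPDE support file (everything proved) for the discharge of the named fact
`Literature.Analysis.FluidPDE.LemarieRieusset2016.lemma13_5_step` (`CKNMorreyBootstrap.lean`;
Lemarié-Rieusset 2016, proof of Lemma 13.5, pp. 475–477). The printed proof writes the
localised velocity `v = φu` as a sum of heat potentials ((13.50)–(13.52), pp. 474–475: the
momentum equation for `v`, the pressure split (13.51) through the equation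
`Δp = -∑∂ⱼ∂ₗ(uⱼuₗ)` (13.19)). The tree obtains such representations **by duality**
(`NSBoundedCaloricDuality.lean`, for `ν = 1` and no force): the momentum equation is tested with
`ψ = (φη)c`, `η = 𝒰[g]` the backward caloric Duhamel integral of a scalar test function `g`, and
the pressure equation with `ϑ = φΞ`, `Ξ = 𝒰[∂_c N g]` (`N` the truncated Newtonian potential),
which removes the only term carrying a derivative of `η` against the pressure. This file proves
the same **master identity for every viscosity `ν > 0` and a divergence-free locally integrable
force `f`** (`integral_cutoff_mul_test_mul_inner_eq_nu`), in the grouped form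

  `∫_Q φ g u_c = ∫_Q AV + ∫_Q BV`,

`AV = (∂ₜφ + νΔφ) u_c η + ∑ᵢ 2ν∂ᵢφ u_c ∂ᵢη + ∑ᵢ ∂ᵢφ uᵢu_c η + ∑ᵢ φ uᵢu_c ∂ᵢη + ∂_cφ p η + φ f_c η`,
`BV = φ p L - Δφ p Ξ - ∑ᵢ 2∂ᵢφ p ∂ᵢΞ - ∑ᵢⱼ φ uᵢuⱼ ∂ⱼ∂ᵢΞ - ∑ᵢⱼ ∂ⱼ∂ᵢφ uᵢuⱼ Ξ - ∑ᵢⱼ 2∂ⱼφ uⱼuᵢ ∂ᵢΞ`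
(`L = 𝒰_ν[Λ ∂_c g]`), together with the integrability of `AV` and `BV` on `Q`, which is the shape
consumed by the Morrey estimate of `CKNMorreyDualEstimate.lean`. The proof is that of
`NSBoundedCaloricDuality.integral_cutoff_mul_test_mul_inner_eq` with the backward heat equation
`∂ₜη + νΔη = -g` and `ΔΞ = ∂_cη - L` for general `ν` (`CaloricDualTestFields.lean`) and the
pressure equation with force (`DistributionalPressurePoisson.lean`).

## References

* P. G. Lemarié-Rieusset, *The Navier–Stokes Problem in the 21st Century*, CRC Press (2016),
  (13.16), (13.19) p. 461, §13.9 Step 3 (13.50)–(13.52) pp. 474–475. [LemarieRieusset2016]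
* G. Seregin, V. Šverák, Comm. PDE 34 (2009) = arXiv:0804.1803, §2 (the duality mechanism).
  [SereginSverak2009]
-/

noncomputable section

open MeasureTheory Set Function Filter TopologicalSpace Metric
open scoped Topology RealInnerProductSpace Laplacian ENNReal

namespace Literature.Analysis.FluidPDE

section Master

variable {Q : Opens (ℝ × EuclideanSpace ℝ (Fin 3))} {ν : ℝ}
  {f u : ℝ → EuclideanSpace ℝ (Fin 3) → EuclideanSpace ℝ (Fin 3)} {p : ℝ → EuclideanSpace ℝ (Fin 3) → ℝ}
  {φ g η Ξ L : ℝ → EuclideanSpace ℝ (Fin 3) → ℝ} {r₀ r₁ : ℝ} {c : EuclideanSpace ℝ (Fin 3)}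
  {ι : Type*} [Fintype ι]

variable (hns : IsDistributionalNSSolutionOn Q ν f u p) (hν : 0 < ν)
  (hf : LocallyIntegrableOn (uncurry f) (Q : Set (ℝ × EuclideanSpace ℝ (Fin 3))) volume)
  (hdivf : ∀ φ' : ℝ → EuclideanSpace ℝ (Fin 3) → ℝ, IsSpaceTimeTestOn Q φ' →
    ∫ z in (Q : Set (ℝ × EuclideanSpace ℝ (Fin 3))), ⟪f z.1 z.2, gradient (φ' z.1) z.2⟫ = 0)
  (hφ : IsSpaceTimeTestOn Q φ)
  (hg : IsSpaceTimeTestOn (⊤ : Opens (ℝ × EuclideanSpace ℝ (Fin 3))) g)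
  (h₀ : 0 < r₀) (h₁ : r₀ < r₁) (b : OrthonormalBasis ι ℝ (EuclideanSpace ℝ (Fin 3)))
  (hη : η = heatDuhamelBack ν g)
  (hΞ : Ξ = heatDuhamelBack ν (fun t y => fderiv ℝ (newtonNearPotential r₀ r₁ (g t)) y c))
  (hL : L = heatDuhamelBack ν (fun t y => newtonFarSmoothing r₀ r₁ (fun y' => fderiv ℝ (g t) y' c) y))

include hg h₀ h₁ hν in
omit [Fintype ι] in
/-- `η`, `Ξ`, `L` are jointly smooth, for every viscosity. [folklore] -/
theorem contDiff_uncurry_caloric_fields_nu (hη : η = heatDuhamelBack ν g)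
    (hΞ : Ξ = heatDuhamelBack ν (fun t y => fderiv ℝ (newtonNearPotential r₀ r₁ (g t)) y c))
    (hL : L = heatDuhamelBack ν (fun t y => newtonFarSmoothing r₀ r₁ (fun y' => fderiv ℝ (g t) y' c) y)) :
    ContDiff ℝ ((⊤ : ℕ∞) : WithTop ℕ∞) (uncurry η) ∧ ContDiff ℝ ((⊤ : ℕ∞) : WithTop ℕ∞) (uncurry Ξ) ∧
      ContDiff ℝ ((⊤ : ℕ∞) : WithTop ℕ∞) (uncurry L) := by
  refine ⟨?_, ?_, ?_⟩
  · rw [hη]; exact hg.contDiff_uncurry_heatDuhamelBack_infty hν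
  · rw [hΞ]
    exact (isSpaceTimeTestOn_fderiv_newtonNearPotential_top hg h₀ h₁ c).contDiff_uncurry_heatDuhamelBack_infty
      hν
  · rw [hL]
    exact (isSpaceTimeTestOn_newtonFarSmoothing_top (hg.fderiv_apply_top c) h₀ h₁).contDiff_uncurry_heatDuhamelBack_infty
      hν

include hns hν hf hdivf hφ hg h₀ h₁ hη hΞ hL in
/-- **The master identity of the caloric duality argument, with viscosity and a divergence-free
force** (Lemarié-Rieusset 2016, §13.9 Step 3, pp. 474–475, in dual form: the momentum equation
(13.16) tested with `ψ = (φη)c`, `η = 𝒰_ν[g]`, through the backward heat equation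
`∂ₜη + νΔη = -g`; the pressure term `∫ φ p ∂_cη` eliminated through the pressure equation (13.19)
tested with `ϑ = φΞ`, `Ξ = 𝒰_ν[∂_c N g]`, `ΔΞ = ∂_cη - L`). With `u_c = ⟪u, c⟫`,
`uᵢ = ⟪u, eᵢ⟫`, `f_c = ⟪f, c⟫`:

  `∫_Q φ g u_c = ∫_Q [ (∂ₜφ + νΔφ) u_c η + ∑ᵢ 2ν∂ᵢφ u_c ∂ᵢη + ∑ᵢ ∂ᵢφ uᵢu_c η + ∑ᵢ φ uᵢu_c ∂ᵢη
      + ∂_cφ p η + φ f_c η ]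
    + ∫_Q [ φ p L - Δφ p Ξ - ∑ᵢ 2∂ᵢφ p ∂ᵢΞ - ∑ᵢⱼ φ uᵢuⱼ ∂ⱼ∂ᵢΞ - ∑ᵢⱼ ∂ⱼ∂ᵢφ uᵢuⱼ Ξ
      - ∑ᵢⱼ 2∂ⱼφ uⱼuᵢ ∂ᵢΞ ]`,

the two integrands being integrable on `Q` (this is the `ν = 1`, `f = 0` identity
`integral_cutoff_mul_test_mul_inner_eq` of `NSBoundedCaloricDuality.lean` with the viscosity
and the force restored). [cite: LemarieRieusset2016, §13.9 Step 3 (13.50)–(13.52) pp. 474–475 with (13.19) p. 461] -/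
theorem integral_cutoff_mul_test_mul_inner_eq_nu :
    IntegrableOn (fun z : ℝ × EuclideanSpace ℝ (Fin 3) =>
        (timeDeriv φ z.1 z.2 + ν * (Δ (φ z.1)) z.2) * ⟪u z.1 z.2, c⟫ * η z.1 z.2
        + ∑ i, (2 * ν * fderiv ℝ (φ z.1) z.2 (b i)) * ⟪u z.1 z.2, c⟫ * fderiv ℝ (η z.1) z.2 (b i)
        + ∑ i, fderiv ℝ (φ z.1) z.2 (b i) * (⟪u z.1 z.2, b i⟫ * ⟪u z.1 z.2, c⟫) * η z.1 z.2
        + ∑ i, φ z.1 z.2 * (⟪u z.1 z.2, b i⟫ * ⟪u z.1 z.2, c⟫) * fderiv ℝ (η z.1) z.2 (b i)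
        + fderiv ℝ (φ z.1) z.2 c * p z.1 z.2 * η z.1 z.2
        + φ z.1 z.2 * ⟪f z.1 z.2, c⟫ * η z.1 z.2)
      (Q : Set (ℝ × EuclideanSpace ℝ (Fin 3))) volume ∧
    IntegrableOn (fun z : ℝ × EuclideanSpace ℝ (Fin 3) =>
        φ z.1 z.2 * p z.1 z.2 * L z.1 z.2
        + (-(Δ (φ z.1)) z.2) * p z.1 z.2 * Ξ z.1 z.2
        + ∑ i, (-(2 * fderiv ℝ (φ z.1) z.2 (b i))) * p z.1 z.2 * fderiv ℝ (Ξ z.1) z.2 (b i)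
        + ∑ i, ∑ j, (-(φ z.1 z.2)) * (⟪u z.1 z.2, b i⟫ * ⟪u z.1 z.2, b j⟫) *
            fderiv ℝ (fun y => fderiv ℝ (Ξ z.1) y (b i)) z.2 (b j)
        + ∑ i, ∑ j, (-(fderiv ℝ (fun y => fderiv ℝ (φ z.1) y (b i)) z.2 (b j))) *
            (⟪u z.1 z.2, b i⟫ * ⟪u z.1 z.2, b j⟫) * Ξ z.1 z.2
        + ∑ i, ∑ j, (-(2 * fderiv ℝ (φ z.1) z.2 (b j))) * (⟪u z.1 z.2, b j⟫ * ⟪u z.1 z.2, b i⟫) *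
            fderiv ℝ (Ξ z.1) z.2 (b i))
      (Q : Set (ℝ × EuclideanSpace ℝ (Fin 3))) volume ∧
    ∫ z in (Q : Set (ℝ × EuclideanSpace ℝ (Fin 3))), φ z.1 z.2 * g z.1 z.2 * ⟪u z.1 z.2, c⟫ =
      (∫ z in (Q : Set (ℝ × EuclideanSpace ℝ (Fin 3))),
        ((timeDeriv φ z.1 z.2 + ν * (Δ (φ z.1)) z.2) * ⟪u z.1 z.2, c⟫ * η z.1 z.2
        + ∑ i, (2 * ν * fderiv ℝ (φ z.1) z.2 (b i)) * ⟪u z.1 z.2, c⟫ * fderiv ℝ (η z.1) z.2 (b i)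
        + ∑ i, fderiv ℝ (φ z.1) z.2 (b i) * (⟪u z.1 z.2, b i⟫ * ⟪u z.1 z.2, c⟫) * η z.1 z.2
        + ∑ i, φ z.1 z.2 * (⟪u z.1 z.2, b i⟫ * ⟪u z.1 z.2, c⟫) * fderiv ℝ (η z.1) z.2 (b i)
        + fderiv ℝ (φ z.1) z.2 c * p z.1 z.2 * η z.1 z.2
        + φ z.1 z.2 * ⟪f z.1 z.2, c⟫ * η z.1 z.2))
      + ∫ z in (Q : Set (ℝ × EuclideanSpace ℝ (Fin 3))),
        (φ z.1 z.2 * p z.1 z.2 * L z.1 z.2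
        + (-(Δ (φ z.1)) z.2) * p z.1 z.2 * Ξ z.1 z.2
        + ∑ i, (-(2 * fderiv ℝ (φ z.1) z.2 (b i))) * p z.1 z.2 * fderiv ℝ (Ξ z.1) z.2 (b i)
        + ∑ i, ∑ j, (-(φ z.1 z.2)) * (⟪u z.1 z.2, b i⟫ * ⟪u z.1 z.2, b j⟫) *
            fderiv ℝ (fun y => fderiv ℝ (Ξ z.1) y (b i)) z.2 (b j)
        + ∑ i, ∑ j, (-(fderiv ℝ (fun y => fderiv ℝ (φ z.1) y (b i)) z.2 (b j))) *
            (⟪u z.1 z.2, b i⟫ * ⟪u z.1 z.2, b j⟫) * Ξ z.1 z.2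
        + ∑ i, ∑ j, (-(2 * fderiv ℝ (φ z.1) z.2 (b j))) * (⟪u z.1 z.2, b j⟫ * ⟪u z.1 z.2, b i⟫) *
            fderiv ℝ (Ξ z.1) z.2 (b i)) := by
  classical
  obtain ⟨hηs, hΞs, hLs⟩ := contDiff_uncurry_caloric_fields_nu (c := c) hν hg h₀ h₁ hη hΞ hL
  have hu := hns.1
  have hu2 := hns.2.1
  have hp := hns.2.2.1
  have hmom := hns.2.2.2.2
  set K : Set (ℝ × EuclideanSpace ℝ (Fin 3)) := tsupport (uncurry φ) with hK_def
  have hK : IsCompact K := hφ.hasCompactSupport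
  have hKQ : K ⊆ (Q : Set (ℝ × EuclideanSpace ℝ (Fin 3))) := hφ.tsupport_subset
  -- smoothness of slices
  have hφ2 : ∀ t, ContDiff ℝ 2 (φ t) := fun t => (hφ.contDiff_slice t).of_le two_le_infty
  have hη2 : ∀ t, ContDiff ℝ 2 (η t) := fun t => (contDiff_slice_of_uncurry hηs t).of_le two_le_infty
  have hΞ2 : ∀ t, ContDiff ℝ 2 (Ξ t) := fun t => (contDiff_slice_of_uncurry hΞs t).of_le two_le_infty
  /- ### continuity of the factors -/
  have cφ : Continuous fun z : ℝ × EuclideanSpace ℝ (Fin 3) => φ z.1 z.2 := hφ.contDiff.continuous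
  have cφt : Continuous fun z : ℝ × EuclideanSpace ℝ (Fin 3) => timeDeriv φ z.1 z.2 :=
    hφ.continuous_timeDeriv
  have cφΔ : Continuous fun z : ℝ × EuclideanSpace ℝ (Fin 3) => (Δ (φ z.1)) z.2 := by
    have h := ((hφ.isSmoothSpaceTimeOn univ).laplacian uniqueDiffOn_univ).continuousOn
    rw [univ_prod_univ, continuousOn_univ] at h
    exact h
  have cφi : ∀ v : EuclideanSpace ℝ (Fin 3),
      Continuous fun z : ℝ × EuclideanSpace ℝ (Fin 3) => fderiv ℝ (φ z.1) z.2 v := fun v =>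
    continuous_fderiv_slice_of_contDiff hφ.contDiff v
  have cφij : ∀ v w : EuclideanSpace ℝ (Fin 3), Continuous fun z : ℝ × EuclideanSpace ℝ (Fin 3) =>
      fderiv ℝ (fun y => fderiv ℝ (φ z.1) y v) z.2 w :=
    fun v w => hφ.continuous_fderiv_fderiv_slice v w
  have cη : Continuous fun z : ℝ × EuclideanSpace ℝ (Fin 3) => η z.1 z.2 := hηs.continuous
  have cηi : ∀ v : EuclideanSpace ℝ (Fin 3),
      Continuous fun z : ℝ × EuclideanSpace ℝ (Fin 3) => fderiv ℝ (η z.1) z.2 v := fun v =>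
    continuous_fderiv_slice_of_contDiff hηs v
  have cΞ : Continuous fun z : ℝ × EuclideanSpace ℝ (Fin 3) => Ξ z.1 z.2 := hΞs.continuous
  have cΞi : ∀ v : EuclideanSpace ℝ (Fin 3),
      Continuous fun z : ℝ × EuclideanSpace ℝ (Fin 3) => fderiv ℝ (Ξ z.1) z.2 v := fun v =>
    continuous_fderiv_slice_of_contDiff hΞs v
  have cΞij : ∀ v w : EuclideanSpace ℝ (Fin 3), Continuous fun z : ℝ × EuclideanSpace ℝ (Fin 3) =>
      fderiv ℝ (fun y => fderiv ℝ (Ξ z.1) y v) z.2 w :=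
    fun v w => continuous_fderiv_slice_of_contDiff (contDiff_uncurry_fderiv_slice_apply hΞs v) w
  have cL : Continuous fun z : ℝ × EuclideanSpace ℝ (Fin 3) => L z.1 z.2 := hLs.continuous
  have cg : Continuous fun z : ℝ × EuclideanSpace ℝ (Fin 3) => g z.1 z.2 := hg.contDiff.continuous
  have cp1 : Continuous fun _ : ℝ × EuclideanSpace ℝ (Fin 3) => (1 : ℝ) := continuous_const
  /- ### vanishing of the cut-off factors off `K` -/
  have zφ : ∀ z : ℝ × EuclideanSpace ℝ (Fin 3), z ∉ K → φ z.1 z.2 = 0 := fun z hz =>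
    show uncurry φ z = 0 from image_eq_zero_of_notMem_tsupport hz
  have zφt : ∀ z : ℝ × EuclideanSpace ℝ (Fin 3), z ∉ K →
      timeDeriv φ z.1 z.2 + ν * (Δ (φ z.1)) z.2 = 0 := fun z hz => by
    rw [IsSpaceTimeTestOn.timeDeriv_eq_zero_of_notMem hz, laplacian_slice_eq_zero_of_notMem_tsupport hz,
      mul_zero, add_zero]
  have zφi : ∀ (v : EuclideanSpace ℝ (Fin 3)) (z : ℝ × EuclideanSpace ℝ (Fin 3)), z ∉ K →
      fderiv ℝ (φ z.1) z.2 v = 0 := fun v z hz => by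
    rw [IsSpaceTimeTestOn.fderiv_slice_eq_zero_of_notMem hz]; rfl
  have zφij : ∀ (v w : EuclideanSpace ℝ (Fin 3)) (z : ℝ × EuclideanSpace ℝ (Fin 3)), z ∉ K →
      fderiv ℝ (fun y => fderiv ℝ (φ z.1) y v) z.2 w = 0 := fun v w z hz =>
    fderiv_fderiv_slice_eq_zero_of_notMem_tsupport hz v w
  /- ### integrability of the basic monomials on `K` -/
  have mu : ∀ a : EuclideanSpace ℝ (Fin 3),
      IntegrableOn (fun z : ℝ × EuclideanSpace ℝ (Fin 3) => ⟪u z.1 z.2, a⟫) K volume := fun a =>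
    integrableOn_inner_of_locallyIntegrableOn hK hKQ hu a
  have muu : ∀ a a' : EuclideanSpace ℝ (Fin 3), IntegrableOn
      (fun z : ℝ × EuclideanSpace ℝ (Fin 3) => ⟪u z.1 z.2, a⟫ * ⟪u z.1 z.2, a'⟫) K volume :=
    fun a a' => integrableOn_inner_mul_inner_of_locallyIntegrableOn hK hKQ hu hu2 a a'
  have mp : IntegrableOn (fun z : ℝ × EuclideanSpace ℝ (Fin 3) => p z.1 z.2) K volume :=
    hp.integrableOn_compact_subset hKQ hK
  have mf : IntegrableOn (fun z : ℝ × EuclideanSpace ℝ (Fin 3) => ⟪f z.1 z.2, c⟫) K volume :=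
    (hf.integrableOn_compact_subset hKQ hK).inner_const c
  -- a generic integrability statement
  have INT : ∀ {T m X : ℝ × EuclideanSpace ℝ (Fin 3) → ℝ}, Continuous T → (∀ z, z ∉ K → T z = 0) →
      IntegrableOn m K volume → Continuous X →
      IntegrableOn (fun z => T z * m z * X z) (Q : Set (ℝ × EuclideanSpace ℝ (Fin 3))) volume :=
    fun hT hT0 hm hX => integrableOn_test_mul_mul Q hK hT hT0 hm hX
  /- ### Step V: the momentum equation tested with `ψ = (φη)c` -/
  set ψ : ℝ → EuclideanSpace ℝ (Fin 3) → EuclideanSpace ℝ (Fin 3) := fun t x => (φ t x * η t x) • c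
    with hψ_def
  have hψ : IsSpaceTimeTestOn Q ψ := (hφ.mul_smooth hηs).smul_const' c
  have keyV := hmom ψ hψ
  -- the backward heat equation
  have heat : ∀ t x, timeDeriv η t x + ν * (Δ (η t)) x = -g t x := fun t x => by
    rw [hη]; exact timeDeriv_add_mul_laplacian_heatDuhamelBack hg hν t x
  -- the pointwise integrands
  set AV : ℝ × EuclideanSpace ℝ (Fin 3) → ℝ := fun z =>
    (timeDeriv φ z.1 z.2 + ν * (Δ (φ z.1)) z.2) * ⟪u z.1 z.2, c⟫ * η z.1 z.2
      + ∑ i, (2 * ν * fderiv ℝ (φ z.1) z.2 (b i)) * ⟪u z.1 z.2, c⟫ * fderiv ℝ (η z.1) z.2 (b i)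
      + ∑ i, fderiv ℝ (φ z.1) z.2 (b i) * (⟪u z.1 z.2, b i⟫ * ⟪u z.1 z.2, c⟫) * η z.1 z.2
      + ∑ i, φ z.1 z.2 * (⟪u z.1 z.2, b i⟫ * ⟪u z.1 z.2, c⟫) * fderiv ℝ (η z.1) z.2 (b i)
      + fderiv ℝ (φ z.1) z.2 c * p z.1 z.2 * η z.1 z.2
      + φ z.1 z.2 * ⟪f z.1 z.2, c⟫ * η z.1 z.2 with hAV
  set P6 : ℝ × EuclideanSpace ℝ (Fin 3) → ℝ := fun z =>
    φ z.1 z.2 * p z.1 z.2 * fderiv ℝ (η z.1) z.2 c with hP6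
  set LH : ℝ × EuclideanSpace ℝ (Fin 3) → ℝ := fun z =>
    φ z.1 z.2 * g z.1 z.2 * ⟪u z.1 z.2, c⟫ with hLH
  have hptV : ∀ z : ℝ × EuclideanSpace ℝ (Fin 3),
      ⟪u z.1 z.2, timeDeriv ψ z.1 z.2⟫ + ⟪u z.1 z.2, convect (u z.1) (ψ z.1) z.2⟫ +
        ν * ⟪u z.1 z.2, (Δ (ψ z.1)) z.2⟫ + p z.1 z.2 * VectorCalculus.divergence (ψ z.1) z.2 +
        ⟪f z.1 z.2, ψ z.1 z.2⟫ =
      AV z + P6 z - LH z := by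
    rintro ⟨t, x⟩
    have e1 : timeDeriv ψ t x = (timeDeriv φ t x * η t x + φ t x * timeDeriv η t x) • c :=
      timeDeriv_mulSmul hφ.contDiff hηs c t x
    have e2 : convect (u t) (ψ t) x =
        (fderiv ℝ (φ t) x (u t x) * η t x + φ t x * fderiv ℝ (η t) x (u t x)) • c :=
      convect_mulSmul hφ.contDiff hηs c (u t) t x
    have e3 : (Δ (ψ t)) x = (φ t x * (Δ (η t)) x + η t x * (Δ (φ t)) x +
        2 * ∑ i, fderiv ℝ (φ t) x (b i) * fderiv ℝ (η t) x (b i)) • c :=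
      laplacian_mulSmul b hφ.contDiff hηs c t x
    have e4 : VectorCalculus.divergence (ψ t) x = fderiv ℝ (φ t) x c * η t x + φ t x * fderiv ℝ (η t) x c :=
      divergence_mulSmul hφ.contDiff hηs c t x
    have e5 : fderiv ℝ (φ t) x (u t x) = ∑ i, ⟪u t x, b i⟫ * fderiv ℝ (φ t) x (b i) :=
      fderiv_apply_eq_sum_inner b (φ t) x (u t x)
    have e6 : fderiv ℝ (η t) x (u t x) = ∑ i, ⟪u t x, b i⟫ * fderiv ℝ (η t) x (b i) :=
      fderiv_apply_eq_sum_inner b (η t) x (u t x)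
    have e7 := heat t x
    have e8 : ⟪f t x, ψ t x⟫ = φ t x * η t x * ⟪f t x, c⟫ := by
      simp only [hψ_def, real_inner_smul_right]
    simp only [hAV, hP6, hLH]
    rw [e1, e2, e3, e4, e8]
    simp only [real_inner_smul_right]
    have E3 : ν * (2 * (∑ i, fderiv ℝ (φ t) x (b i) * fderiv ℝ (η t) x (b i))) * ⟪u t x, c⟫ =
        ∑ i, 2 * ν * fderiv ℝ (φ t) x (b i) * ⟪u t x, c⟫ * fderiv ℝ (η t) x (b i) := by
      rw [Finset.mul_sum, Finset.mul_sum, Finset.sum_mul]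
      exact Finset.sum_congr rfl fun i _ => by ring
    have E5 : fderiv ℝ (φ t) x (u t x) * η t x * ⟪u t x, c⟫ =
        ∑ i, fderiv ℝ (φ t) x (b i) * (⟪u t x, b i⟫ * ⟪u t x, c⟫) * η t x := by
      rw [e5, Finset.sum_mul, Finset.sum_mul]
      exact Finset.sum_congr rfl fun i _ => by ring
    have E6 : φ t x * fderiv ℝ (η t) x (u t x) * ⟪u t x, c⟫ =
        ∑ i, φ t x * (⟪u t x, b i⟫ * ⟪u t x, c⟫) * fderiv ℝ (η t) x (b i) := by
      rw [e6, Finset.mul_sum, Finset.sum_mul]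
      exact Finset.sum_congr rfl fun i _ => by ring
    linear_combination (φ t x * ⟪u t x, c⟫) * e7 + E5 + E6 + E3
  /- ### Step P: the pressure equation tested with `ϑ = φΞ` -/
  have hθ : IsSpaceTimeTestOn Q (fun t x => φ t x * Ξ t x) := hφ.mul_smooth hΞs
  have keyP := hns.integral_hessian_add_pressure_laplacian_eq_zero hf hdivf hθ
  -- `ΔΞ = ∂_cη - L`
  have lapΞ : ∀ t x, (Δ (Ξ t)) x = fderiv ℝ (η t) x c - L t x := fun t x => by
    rw [hΞ, hη, hL]; exact laplacian_heatDuhamelBack_fderiv_newtonNearPotential_nu hg h₀ h₁ hν c t x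
  set BV : ℝ × EuclideanSpace ℝ (Fin 3) → ℝ := fun z =>
    φ z.1 z.2 * p z.1 z.2 * L z.1 z.2
      + (-(Δ (φ z.1)) z.2) * p z.1 z.2 * Ξ z.1 z.2
      + ∑ i, (-(2 * fderiv ℝ (φ z.1) z.2 (b i))) * p z.1 z.2 * fderiv ℝ (Ξ z.1) z.2 (b i)
      + ∑ i, ∑ j, (-(φ z.1 z.2)) * (⟪u z.1 z.2, b i⟫ * ⟪u z.1 z.2, b j⟫) *
          fderiv ℝ (fun y => fderiv ℝ (Ξ z.1) y (b i)) z.2 (b j)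
      + ∑ i, ∑ j, (-(fderiv ℝ (fun y => fderiv ℝ (φ z.1) y (b i)) z.2 (b j))) *
          (⟪u z.1 z.2, b i⟫ * ⟪u z.1 z.2, b j⟫) * Ξ z.1 z.2
      + ∑ i, ∑ j, (-(2 * fderiv ℝ (φ z.1) z.2 (b j))) * (⟪u z.1 z.2, b j⟫ * ⟪u z.1 z.2, b i⟫) *
          fderiv ℝ (Ξ z.1) z.2 (b i) with hBV
  have hptP : ∀ z : ℝ × EuclideanSpace ℝ (Fin 3),
      fderiv ℝ (fderiv ℝ ((fun t x => φ t x * Ξ t x) z.1)) z.2 (u z.1 z.2) (u z.1 z.2) +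
        p z.1 z.2 * (Δ ((fun t x => φ t x * Ξ t x) z.1)) z.2 = P6 z - BV z := by
    rintro ⟨t, x⟩
    have hD : DifferentiableAt ℝ (fderiv ℝ (φ t)) x :=
      (((hφ2 t).fderiv_right (m := 1) le_rfl).differentiable one_ne_zero) x
    have p1 := hessian_mul_apply_apply (hφ2 t) (hΞ2 t) x (u t x)
    have p2 : fderiv ℝ (fun y => fderiv ℝ (Ξ t) y (u t x)) x (u t x) =
        ∑ i, ∑ j, (⟪u t x, b i⟫ * ⟪u t x, b j⟫) * fderiv ℝ (fun y => fderiv ℝ (Ξ t) y (b i)) x (b j) :=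
      fderiv_fderiv_apply_eq_sum b (hΞ2 t) x (u t x)
    have p3 : fderiv ℝ (fderiv ℝ (φ t)) x (u t x) (u t x) =
        ∑ i, ∑ j, (⟪u t x, b i⟫ * ⟪u t x, b j⟫) * fderiv ℝ (fun y => fderiv ℝ (φ t) y (b i)) x (b j) := by
      rw [← fderiv_apply_const_apply hD (u t x) (u t x)]
      exact fderiv_fderiv_apply_eq_sum b (hφ2 t) x (u t x)
    have p4 : fderiv ℝ (φ t) x (u t x) = ∑ j, ⟪u t x, b j⟫ * fderiv ℝ (φ t) x (b j) :=
      fderiv_apply_eq_sum_inner b (φ t) x (u t x)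
    have p5 : fderiv ℝ (Ξ t) x (u t x) = ∑ i, ⟪u t x, b i⟫ * fderiv ℝ (Ξ t) x (b i) :=
      fderiv_apply_eq_sum_inner b (Ξ t) x (u t x)
    have p6 := laplacian_mul_eq b (hφ2 t) (hΞ2 t) x
    have p7 := lapΞ t x
    simp only [hP6, hBV]
    change fderiv ℝ (fderiv ℝ (fun y => φ t y * Ξ t y)) x (u t x) (u t x) +
      p t x * (Δ (fun y => φ t y * Ξ t y)) x = _
    rw [p1, p2, p3, p4, p5, p6, p7]
    -- distribute
    have hs4 : (2 * ((∑ j, ⟪u t x, b j⟫ * fderiv ℝ (φ t) x (b j)) *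
        ∑ i, ⟪u t x, b i⟫ * fderiv ℝ (Ξ t) x (b i))) =
        -∑ i, ∑ j, (-(2 * fderiv ℝ (φ t) x (b j))) * (⟪u t x, b j⟫ * ⟪u t x, b i⟫) *
          fderiv ℝ (Ξ t) x (b i) := by
      rw [Finset.sum_mul_sum, Finset.sum_comm, Finset.mul_sum, ← Finset.sum_neg_distrib]
      refine Finset.sum_congr rfl fun i _ => ?_
      rw [Finset.mul_sum, ← Finset.sum_neg_distrib]
      refine Finset.sum_congr rfl fun j _ => ?_
      ring
    have hs5 : φ t x * ∑ i, ∑ j, ⟪u t x, b i⟫ * ⟪u t x, b j⟫ *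
        fderiv ℝ (fun y => fderiv ℝ (Ξ t) y (b i)) x (b j) =
        -∑ i, ∑ j, (-(φ t x)) * (⟪u t x, b i⟫ * ⟪u t x, b j⟫) *
          fderiv ℝ (fun y => fderiv ℝ (Ξ t) y (b i)) x (b j) := by
      rw [Finset.mul_sum, ← Finset.sum_neg_distrib]
      refine Finset.sum_congr rfl fun i _ => ?_
      rw [Finset.mul_sum, ← Finset.sum_neg_distrib]
      refine Finset.sum_congr rfl fun j _ => ?_
      ring
    have hs6 : Ξ t x * ∑ i, ∑ j, ⟪u t x, b i⟫ * ⟪u t x, b j⟫ *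
        fderiv ℝ (fun y => fderiv ℝ (φ t) y (b i)) x (b j) =
        -∑ i, ∑ j, (-(fderiv ℝ (fun y => fderiv ℝ (φ t) y (b i)) x (b j))) *
          (⟪u t x, b i⟫ * ⟪u t x, b j⟫) * Ξ t x := by
      rw [Finset.mul_sum, ← Finset.sum_neg_distrib]
      refine Finset.sum_congr rfl fun i _ => ?_
      rw [Finset.mul_sum, ← Finset.sum_neg_distrib]
      refine Finset.sum_congr rfl fun j _ => ?_
      ring
    have hs7 : p t x * (2 * ∑ i, fderiv ℝ (φ t) x (b i) * fderiv ℝ (Ξ t) x (b i)) =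
        -∑ i, (-(2 * fderiv ℝ (φ t) x (b i))) * p t x * fderiv ℝ (Ξ t) x (b i) := by
      rw [Finset.mul_sum, Finset.mul_sum, ← Finset.sum_neg_distrib]
      refine Finset.sum_congr rfl fun i _ => ?_
      ring
    have halg : φ t x * (∑ i, ∑ j, ⟪u t x, b i⟫ * ⟪u t x, b j⟫ *
          fderiv ℝ (fun y => fderiv ℝ (Ξ t) y (b i)) x (b j)) +
        Ξ t x * (∑ i, ∑ j, ⟪u t x, b i⟫ * ⟪u t x, b j⟫ *
          fderiv ℝ (fun y => fderiv ℝ (φ t) y (b i)) x (b j)) +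
        2 * ((∑ j, ⟪u t x, b j⟫ * fderiv ℝ (φ t) x (b j)) * ∑ i, ⟪u t x, b i⟫ * fderiv ℝ (Ξ t) x (b i)) +
        p t x * (φ t x * (fderiv ℝ (η t) x c - L t x) + Ξ t x * (Δ (φ t)) x +
          2 * ∑ i, fderiv ℝ (φ t) x (b i) * fderiv ℝ (Ξ t) x (b i)) =
        φ t x * p t x * fderiv ℝ (η t) x c -
          (φ t x * p t x * L t x + (-(Δ (φ t)) x) * p t x * Ξ t x +
            ∑ i, (-(2 * fderiv ℝ (φ t) x (b i))) * p t x * fderiv ℝ (Ξ t) x (b i) +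
            ∑ i, ∑ j, (-(φ t x)) * (⟪u t x, b i⟫ * ⟪u t x, b j⟫) *
              fderiv ℝ (fun y => fderiv ℝ (Ξ t) y (b i)) x (b j) +
            ∑ i, ∑ j, (-(fderiv ℝ (fun y => fderiv ℝ (φ t) y (b i)) x (b j))) *
              (⟪u t x, b i⟫ * ⟪u t x, b j⟫) * Ξ t x +
            ∑ i, ∑ j, (-(2 * fderiv ℝ (φ t) x (b j))) * (⟪u t x, b j⟫ * ⟪u t x, b i⟫) *
              fderiv ℝ (Ξ t) x (b i)) := by
      rw [hs5, hs6, hs4, mul_add (p t x), mul_add (p t x), hs7]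
      ring
    exact halg
  /- ### integrability of every term -/
  have iLH : IntegrableOn LH (Q : Set (ℝ × EuclideanSpace ℝ (Fin 3))) volume := by
    have h := INT cφ zφ (mu c) cg
    refine h.congr_fun (fun z _ => ?_) Q.isOpen.measurableSet
    simp only [hLH]; ring
  have iP6 : IntegrableOn P6 (Q : Set (ℝ × EuclideanSpace ℝ (Fin 3))) volume := INT cφ zφ mp (cηi c)
  have iA1 : IntegrableOn (fun z : ℝ × EuclideanSpace ℝ (Fin 3) =>
      (timeDeriv φ z.1 z.2 + ν * (Δ (φ z.1)) z.2) * ⟪u z.1 z.2, c⟫ * η z.1 z.2) Q volume :=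
    INT (cφt.add (continuous_const.mul cφΔ)) zφt (mu c) cη
  have iA2 : ∀ i, IntegrableOn (fun z : ℝ × EuclideanSpace ℝ (Fin 3) =>
      (2 * ν * fderiv ℝ (φ z.1) z.2 (b i)) * ⟪u z.1 z.2, c⟫ * fderiv ℝ (η z.1) z.2 (b i)) Q volume :=
    fun i =>
    INT (continuous_const.mul (cφi (b i))) (fun z hz => by rw [zφi (b i) z hz, mul_zero]) (mu c) (cηi (b i))
  have iA6 : IntegrableOn (fun z : ℝ × EuclideanSpace ℝ (Fin 3) =>
      φ z.1 z.2 * ⟪f z.1 z.2, c⟫ * η z.1 z.2) Q volume := INT cφ zφ mf cη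
  have iA3 : ∀ i, IntegrableOn (fun z : ℝ × EuclideanSpace ℝ (Fin 3) =>
      fderiv ℝ (φ z.1) z.2 (b i) * (⟪u z.1 z.2, b i⟫ * ⟪u z.1 z.2, c⟫) * η z.1 z.2) Q volume := fun i =>
    INT (cφi (b i)) (zφi (b i)) (muu (b i) c) cη
  have iA4 : ∀ i, IntegrableOn (fun z : ℝ × EuclideanSpace ℝ (Fin 3) =>
      φ z.1 z.2 * (⟪u z.1 z.2, b i⟫ * ⟪u z.1 z.2, c⟫) * fderiv ℝ (η z.1) z.2 (b i)) Q volume := fun i =>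
    INT cφ zφ (muu (b i) c) (cηi (b i))
  have iA5 : IntegrableOn (fun z : ℝ × EuclideanSpace ℝ (Fin 3) =>
      fderiv ℝ (φ z.1) z.2 c * p z.1 z.2 * η z.1 z.2) Q volume := INT (cφi c) (zφi c) mp cη
  have iB1 : IntegrableOn (fun z : ℝ × EuclideanSpace ℝ (Fin 3) => φ z.1 z.2 * p z.1 z.2 * L z.1 z.2) Q
      volume := INT cφ zφ mp cL
  have iB2 : IntegrableOn (fun z : ℝ × EuclideanSpace ℝ (Fin 3) =>
      (-(Δ (φ z.1)) z.2) * p z.1 z.2 * Ξ z.1 z.2) Q volume :=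
    INT cφΔ.neg (fun z hz => by rw [laplacian_slice_eq_zero_of_notMem_tsupport hz, neg_zero]) mp cΞ
  have iB3 : ∀ i, IntegrableOn (fun z : ℝ × EuclideanSpace ℝ (Fin 3) =>
      (-(2 * fderiv ℝ (φ z.1) z.2 (b i))) * p z.1 z.2 * fderiv ℝ (Ξ z.1) z.2 (b i)) Q volume := fun i =>
    INT (continuous_const.mul (cφi (b i))).neg
      (fun z hz => by rw [zφi (b i) z hz, mul_zero, neg_zero]) mp (cΞi (b i))
  have iB4 : ∀ i j, IntegrableOn (fun z : ℝ × EuclideanSpace ℝ (Fin 3) =>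
      (-(φ z.1 z.2)) * (⟪u z.1 z.2, b i⟫ * ⟪u z.1 z.2, b j⟫) *
        fderiv ℝ (fun y => fderiv ℝ (Ξ z.1) y (b i)) z.2 (b j)) Q volume := fun i j =>
    INT cφ.neg (fun z hz => by rw [zφ z hz, neg_zero]) (muu (b i) (b j)) (cΞij (b i) (b j))
  have iB5 : ∀ i j, IntegrableOn (fun z : ℝ × EuclideanSpace ℝ (Fin 3) =>
      (-(fderiv ℝ (fun y => fderiv ℝ (φ z.1) y (b i)) z.2 (b j))) * (⟪u z.1 z.2, b i⟫ * ⟪u z.1 z.2, b j⟫) *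
        Ξ z.1 z.2) Q volume := fun i j =>
    INT (cφij (b i) (b j)).neg (fun z hz => by rw [zφij (b i) (b j) z hz, neg_zero])
      (muu (b i) (b j)) cΞ
  have iB6 : ∀ i j, IntegrableOn (fun z : ℝ × EuclideanSpace ℝ (Fin 3) =>
      (-(2 * fderiv ℝ (φ z.1) z.2 (b j))) * (⟪u z.1 z.2, b j⟫ * ⟪u z.1 z.2, b i⟫) *
        fderiv ℝ (Ξ z.1) z.2 (b i)) Q volume := fun i j =>
    INT (continuous_const.mul (cφi (b j))).neg
      (fun z hz => by rw [zφi (b j) z hz, mul_zero, neg_zero]) (muu (b j) (b i)) (cΞi (b i))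
  -- integrability of the sums
  have iA2s : IntegrableOn (fun z : ℝ × EuclideanSpace ℝ (Fin 3) =>
      ∑ i, (2 * ν * fderiv ℝ (φ z.1) z.2 (b i)) * ⟪u z.1 z.2, c⟫ * fderiv ℝ (η z.1) z.2 (b i)) Q volume :=
    integrable_finsetSum _ fun i _ => iA2 i
  have iA3s : IntegrableOn (fun z : ℝ × EuclideanSpace ℝ (Fin 3) =>
      ∑ i, fderiv ℝ (φ z.1) z.2 (b i) * (⟪u z.1 z.2, b i⟫ * ⟪u z.1 z.2, c⟫) * η z.1 z.2) Q volume :=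
    integrable_finsetSum _ fun i _ => iA3 i
  have iA4s : IntegrableOn (fun z : ℝ × EuclideanSpace ℝ (Fin 3) =>
      ∑ i, φ z.1 z.2 * (⟪u z.1 z.2, b i⟫ * ⟪u z.1 z.2, c⟫) * fderiv ℝ (η z.1) z.2 (b i)) Q volume :=
    integrable_finsetSum _ fun i _ => iA4 i
  have iB3s : IntegrableOn (fun z : ℝ × EuclideanSpace ℝ (Fin 3) =>
      ∑ i, (-(2 * fderiv ℝ (φ z.1) z.2 (b i))) * p z.1 z.2 * fderiv ℝ (Ξ z.1) z.2 (b i)) Q volume :=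
    integrable_finsetSum _ fun i _ => iB3 i
  have iB4s : IntegrableOn (fun z : ℝ × EuclideanSpace ℝ (Fin 3) =>
      ∑ i, ∑ j, (-(φ z.1 z.2)) * (⟪u z.1 z.2, b i⟫ * ⟪u z.1 z.2, b j⟫) *
        fderiv ℝ (fun y => fderiv ℝ (Ξ z.1) y (b i)) z.2 (b j)) Q volume :=
    integrable_finsetSum _ fun i _ => integrable_finsetSum _ fun j _ => iB4 i j
  have iB5s : IntegrableOn (fun z : ℝ × EuclideanSpace ℝ (Fin 3) =>
      ∑ i, ∑ j, (-(fderiv ℝ (fun y => fderiv ℝ (φ z.1) y (b i)) z.2 (b j))) *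
        (⟪u z.1 z.2, b i⟫ * ⟪u z.1 z.2, b j⟫) * Ξ z.1 z.2) Q volume :=
    integrable_finsetSum _ fun i _ => integrable_finsetSum _ fun j _ => iB5 i j
  have iB6s : IntegrableOn (fun z : ℝ × EuclideanSpace ℝ (Fin 3) =>
      ∑ i, ∑ j, (-(2 * fderiv ℝ (φ z.1) z.2 (b j))) * (⟪u z.1 z.2, b j⟫ * ⟪u z.1 z.2, b i⟫) *
        fderiv ℝ (Ξ z.1) z.2 (b i)) Q volume :=
    integrable_finsetSum _ fun i _ => integrable_finsetSum _ fun j _ => iB6 i j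
  have iAV : IntegrableOn AV (Q : Set (ℝ × EuclideanSpace ℝ (Fin 3))) volume :=
    ((((iA1.fun_add iA2s).fun_add iA3s).fun_add iA4s).fun_add iA5).fun_add iA6
  have iBV : IntegrableOn BV (Q : Set (ℝ × EuclideanSpace ℝ (Fin 3))) volume :=
    ((((iB1.fun_add iB2).fun_add iB3s).fun_add iB4s).fun_add iB5s).fun_add iB6s
  /- ### integrate the two pointwise identities -/
  have intV : ∫ z in (Q : Set (ℝ × EuclideanSpace ℝ (Fin 3))), (AV z + P6 z - LH z) = 0 := by
    rw [← keyV]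
    exact setIntegral_congr_fun Q.isOpen.measurableSet fun z _ => (hptV z).symm
  have intP : ∫ z in (Q : Set (ℝ × EuclideanSpace ℝ (Fin 3))), (P6 z - BV z) = 0 := by
    rw [← keyP]
    exact setIntegral_congr_fun Q.isOpen.measurableSet fun z _ => (hptP z).symm
  rw [integral_sub (iAV.fun_add iP6) iLH, integral_add iAV iP6] at intV
  rw [integral_sub iP6 iBV] at intP
  have main : ∫ z in (Q : Set (ℝ × EuclideanSpace ℝ (Fin 3))), LH z =
      (∫ z in (Q : Set (ℝ × EuclideanSpace ℝ (Fin 3))), AV z) +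
        ∫ z in (Q : Set (ℝ × EuclideanSpace ℝ (Fin 3))), BV z := by linarith
  exact ⟨iAV, iBV, main⟩

end Master

end Literature.Analysis.FluidPDE
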